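import Literature.AlgebraicGeometry.ShimuraVarieties.UnitaryBallSpecialCurveDatum
import Literature.NumberTheory.Automorphic.UnitaryGroupFrameStabiliser
import Literature.NumberTheory.Automorphic.UnitaryGroupFormTransport
import HarnessLib

/-!
# The stabiliser `Γ_W` of a framed line, in block form: `Γ_W = Γ ∩ B·(U(J⋆) × U(J⊥))·B⁻¹ = Stab_Γ(W^⊥)`

Topic `AlgebraicGeometry/ShimuraVarieties`; namespaces `Literature.AlgebraicGeometry.ShimuraVarieties` (§1 generic block
algebra) and `….UnitaryBallUniformisationDatum` (§§2–3).  THEOREMS ONLY (no definition, no named fact, no instance).  The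
CURRENCY BRIDGE between the line-stabiliser `D.lineStab W` of `UnitaryBallSpecialDiscAction` — the language of the
hypotheses `hinj`, `hΓΓ₁` of `exists_specialCurveSubscheme` / `exists_specialCurveDatum` — and the FRAME language of
`UnitaryGroupFrameStabiliser` / `UnitaryGroupFrameEmbeddingLevels` / `UnitaryShimuraCurveEmbeddingInjective`
(«`γ·B(x ⊕ 0) ∈ B(E² ⊕ 0)`», `γ = B·(γ₁ ⊕ ζ)·B⁻¹`), for a frame `ᵗσ(B)·H·B = J⋆ ⊕ᶠ J⊥` of the hermitian space of
`D : UnitaryBallUniformisationDatum 2 X` and the line `W = E·(B e₃)`: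

* §1 `fromBlocks_zero₁₂_mem_unitary_iff`, `exists_eq_reindexGL_blockDiagGL_of_apply_castAdd_natAdd_eq_zero` — a
  `σ`-unitary matrix for `J₁ ⊕ J₂` (`J₂` non-degenerate) whose UPPER-RIGHT block vanishes is block diagonal with unitary
  blocks (the mirror image of `UnitaryGroup.fromBlocks_zero₂₁_mem_unitary_iff` /
  `exists_eq_blockDiagFin_of_apply_natAdd_castAdd_eq_zero`, which treat the LOWER-LEFT block and need `J₁` non-degenerate);
* §2 `exists_mulVec_eq_smul_of_mem_lineStab` / `mem_lineStab_of_mulVec_eq_smul` — `γ ∈ Γ_{E·s}` iff `γ s = ζ s`;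
* §3 `exists_eq_conj_blockDiag_of_mem_lineStab`, `conj_blockDiagGL_mem_lineStab`, **`mem_lineStab_iff_exists_conj_blockDiag`**
  (`γ ∈ Γ_W ↔ γ = B(γ₁ ⊕ ζ)B⁻¹`) and **`mem_lineStab_iff_mapsTo_frame`** (`γ ∈ Γ_W ↔ ∀ x ∃ y, γ·B(x ⊕ 0) = B(y ⊕ 0)`, i.e.
  `Stab_Γ(W) = Stab_Γ(W^⊥)` for the unitary `Γ`).

References: P. Deligne, *Travaux de Shimura* (1971), proof of Prop. 1.15, p. 132 (`Stab = U(W^⊥) × U(W)`); S. Kudla,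
*Seesaw dual reductive pairs* (1984), §1; S. Kudla, J. Millson, Publ. Math. IHÉS 71 (1990), Lemma 1.1.
Cell `hodgecm-mathlib`, road (ii) (R2-2 / L5 consumers).  HC_CM is proved only modulo the 7 printed citations until rung 0
closes; nothing here is in a registered cone.
-/

set_option autoImplicit false

noncomputable section

open Matrix NumberField Function
open Literature.NumberTheory.Automorphic
open Literature.NumberTheory.Automorphic.UnitaryGroup (finSum reindexGL blockDiagGL finSum_submatrix coe_reindexGL
  coe_blockDiagGL finSum_mulVec_append)
open Literature.NumberTheory.Transcendental Literature.AlgebraicGeometry.Motives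

namespace Literature.AlgebraicGeometry.ShimuraVarieties

/-! ### §1 Block algebra: a unitary matrix with vanishing upper-right block is block diagonal -/

section Blocks

variable {S : Type*} [Field S] (σ : S →+* S) {n₁ n₂ : Type*} [Fintype n₁] [Fintype n₂] [DecidableEq n₂]

/-- **A `σ`-unitary matrix for `J₁ ⊕ J₂` whose upper-right block vanishes is block diagonal, with `σ`-unitary
diagonal blocks** (`J₂` non-degenerate): `M = [[P, 0], [R, T]]` satisfies `ᵗ(σM)·(J₁ ⊕ J₂)·M = J₁ ⊕ J₂` iff `R = 0`,
`ᵗ(σP)·J₁·P = J₁` and `ᵗ(σT)·J₂·T = J₂` (mirror image of `UnitaryGroup.fromBlocks_zero₂₁_mem_unitary_iff`).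
[cite: Deligne1971TravauxShimura, Prop. 1.15 (proof, p. 132)] [cite: Kudla1984, §1] -/
theorem fromBlocks_zero₁₂_mem_unitary_iff {J₁ : Matrix n₁ n₁ S} {J₂ : Matrix n₂ n₂ S} (hJ₂ : J₂.det ≠ 0)
    (P : Matrix n₁ n₁ S) (R : Matrix n₂ n₁ S) (T : Matrix n₂ n₂ S) :
    ((Matrix.fromBlocks P 0 R T).map σ)ᵀ * Matrix.fromBlocks J₁ 0 0 J₂ * Matrix.fromBlocks P 0 R T =
        Matrix.fromBlocks J₁ 0 0 J₂ ↔
      R = 0 ∧ (P.map σ)ᵀ * J₁ * P = J₁ ∧ (T.map σ)ᵀ * J₂ * T = J₂ := by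
  rw [Matrix.fromBlocks_map, Matrix.fromBlocks_transpose, Matrix.map_zero σ (map_zero σ), Matrix.transpose_zero,
    Matrix.fromBlocks_multiply, Matrix.fromBlocks_multiply]
  simp only [Matrix.mul_zero, Matrix.zero_mul, add_zero, zero_add]
  rw [Matrix.fromBlocks_inj]
  constructor
  · rintro ⟨h11, -, h21, h22⟩
    -- `ᵗ(σT)·J₂` is invertible: `σ(det T) · det J₂ · det T = det J₂`
    have hdet := congrArg Matrix.det h22
    have hTσ : ((T.map σ)ᵀ * J₂).det ≠ 0 := by
      intro h0
      rw [Matrix.det_mul, h0, zero_mul] at hdet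
      exact hJ₂ hdet.symm
    have hR : R = 0 := by
      have hu : IsUnit ((T.map σ)ᵀ * J₂).det := isUnit_iff_ne_zero.2 hTσ
      calc R = ((T.map σ)ᵀ * J₂)⁻¹ * (((T.map σ)ᵀ * J₂) * R) := (Matrix.nonsing_inv_mul_cancel_left _ R hu).symm
        _ = 0 := by rw [h21, Matrix.mul_zero]
    refine ⟨hR, ?_, h22⟩
    rw [hR, Matrix.map_zero σ (map_zero σ), Matrix.transpose_zero, Matrix.zero_mul, Matrix.zero_mul, add_zero] at h11
    exact h11
  · rintro ⟨hR, hP, hT⟩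
    subst hR
    refine ⟨?_, ?_, ?_, hT⟩
    · rw [Matrix.map_zero σ (map_zero σ), Matrix.transpose_zero, Matrix.zero_mul, Matrix.zero_mul, add_zero, hP]
    · rw [Matrix.map_zero σ (map_zero σ), Matrix.transpose_zero, Matrix.zero_mul, Matrix.zero_mul]
    · rw [Matrix.mul_zero]

end Blocks

section FinBlocks

variable {S : Type*} [Field S] (σ : S →+* S) {N₁ N₂ : ℕ}

/-- **An element of `U(σ, J₁ ⊕ᶠ J₂)` mapping the second summand `0 ⊕ S^{N₂}` into itself is block diagonal**:
`g = blockDiag (γ₁, γ₂)` (concatenated basis) with `γ₁ ∈ U(σ, J₁)`, `γ₂ ∈ U(σ, J₂)` (`J₂` non-degenerate); the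
hypothesis is the entrywise form `g (castAdd i) (natAdd k) = 0` of «`g(0 ⊕ y) ∈ 0 ⊕ S^{N₂}`» (mirror image of
`UnitaryGroup.exists_eq_blockDiagFin_of_apply_natAdd_castAdd_eq_zero`).
[cite: Deligne1971TravauxShimura, Prop. 1.15 (proof, p. 132)] [cite: Kudla1984, §1] -/
theorem exists_eq_reindexGL_blockDiagGL_of_apply_castAdd_natAdd_eq_zero {J₁ : Matrix (Fin N₁) (Fin N₁) S}
    {J₂ : Matrix (Fin N₂) (Fin N₂) S} (hJ₂ : J₂.det ≠ 0) {g : GL (Fin (N₁ + N₂)) S}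
    (hg : g ∈ unitaryGroupOfForm σ (finSum N₁ N₂ J₁ J₂))
    (hV : ∀ (i : Fin N₁) (k : Fin N₂),
      (g : Matrix (Fin (N₁ + N₂)) (Fin (N₁ + N₂)) S) (Fin.castAdd N₂ i) (Fin.natAdd N₁ k) = 0) :
    ∃ (γ₁ : GL (Fin N₁) S) (γ₂ : GL (Fin N₂) S), γ₁ ∈ unitaryGroupOfForm σ J₁ ∧ γ₂ ∈ unitaryGroupOfForm σ J₂ ∧
      g = reindexGL finSumFinEquiv (blockDiagGL (γ₁, γ₂)) := by
  classical
  set M : Matrix (Fin N₁ ⊕ Fin N₂) (Fin N₁ ⊕ Fin N₂) S :=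
    (g : Matrix (Fin (N₁ + N₂)) (Fin (N₁ + N₂)) S).submatrix finSumFinEquiv finSumFinEquiv with hMdef
  have hQ : M.toBlocks₁₂ = 0 := by
    ext i k
    simp only [Matrix.toBlocks₁₂, hMdef, Matrix.submatrix_apply, finSumFinEquiv_apply_left,
      finSumFinEquiv_apply_right, Matrix.of_apply, Matrix.zero_apply]
    exact hV i k
  have hM : M = Matrix.fromBlocks M.toBlocks₁₁ 0 M.toBlocks₂₁ M.toBlocks₂₂ := by
    conv_lhs => rw [← Matrix.fromBlocks_toBlocks M, hQ]
  -- unitarity in `Sum` coordinates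
  have hu : (M.map σ)ᵀ * Matrix.fromBlocks J₁ 0 0 J₂ * M = Matrix.fromBlocks J₁ 0 0 J₂ := by
    have h1 := congrArg (fun A : Matrix (Fin (N₁ + N₂)) (Fin (N₁ + N₂)) S => A.submatrix finSumFinEquiv finSumFinEquiv)
      (mem_unitaryGroupOfForm_iff.1 hg)
    rw [finSum_submatrix, ← Matrix.submatrix_mul_equiv _ _ _ (finSumFinEquiv (m := N₁) (n := N₂)) _,
      ← Matrix.submatrix_mul_equiv _ _ _ (finSumFinEquiv (m := N₁) (n := N₂)) _, finSum_submatrix,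
      ← Matrix.transpose_submatrix, Matrix.submatrix_map, ← hMdef] at h1
    exact h1
  rw [hM] at hu
  obtain ⟨hR, hP, hT⟩ := (fromBlocks_zero₁₂_mem_unitary_iff σ hJ₂ _ _ _).1 hu
  -- the diagonal blocks are invertible (`det g = det P · det T`)
  have hdet : M.toBlocks₁₁.det * M.toBlocks₂₂.det ≠ 0 := by
    rw [← Matrix.det_fromBlocks_zero₁₂ M.toBlocks₁₁ M.toBlocks₂₁ M.toBlocks₂₂, ← hM, hMdef,
      Matrix.det_submatrix_equiv_self]
    exact (Matrix.GeneralLinearGroup.det g).ne_zero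
  refine ⟨Matrix.GeneralLinearGroup.mkOfDetNeZero M.toBlocks₁₁ (left_ne_zero_of_mul hdet),
    Matrix.GeneralLinearGroup.mkOfDetNeZero M.toBlocks₂₂ (right_ne_zero_of_mul hdet), hP, hT, Units.ext ?_⟩
  rw [coe_reindexGL, coe_blockDiagGL]
  change (g : Matrix (Fin (N₁ + N₂)) (Fin (N₁ + N₂)) S) =
    Matrix.reindex finSumFinEquiv finSumFinEquiv (Matrix.fromBlocks M.toBlocks₁₁ 0 0 M.toBlocks₂₂)
  rw [← hR, ← hM, hMdef, Matrix.reindex_apply, Matrix.submatrix_submatrix, Equiv.self_comp_symm,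
    Matrix.submatrix_id_id]

end FinBlocks

namespace UnitaryBallUniformisationDatum

variable {X : SchemeOver ℂ} (D : UnitaryBallUniformisationDatum 2 X)
variable (B : GL (Fin 3) D.E) (Jstar : Matrix (Fin 2) (Fin 2) D.E) (Jperp : Matrix (Fin 1) (Fin 1) D.E)

/-! ### §2 Line stabilisers and eigen-lines -/

/-- An element of the stabiliser `Γ_{E·s}` multiplies `s` by a scalar. [cite: KudlaMillson1990, Lemma 1.1, p. 128] -/
theorem exists_mulVec_eq_smul_of_mem_lineStab {s : Fin 3 → D.E} {γ : D.Γ} (hγ : γ ∈ D.lineStab (D.E ∙ s)) :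
    ∃ ζ : D.E, ((γ : GL (Fin 3) D.E) : Matrix (Fin 3) (Fin 3) D.E) *ᵥ s = ζ • s := by
  have h := ((D.mem_lineStab_iff.1 hγ) s).1 (Submodule.mem_span_singleton_self s)
  obtain ⟨ζ, hζ⟩ := Submodule.mem_span_singleton.1 h
  exact ⟨ζ, hζ.symm⟩

/-- Conversely, `γ s = ζ•s` with `s ≠ 0` puts `γ ∈ Γ` in the stabiliser of the line `E·s` (no unitarity needed: `ζ ≠ 0`
and `γ⁻¹ s = ζ⁻¹•s`). [cite: KudlaMillson1990, Lemma 1.1, p. 128] -/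
theorem mem_lineStab_of_mulVec_eq_smul {s : Fin 3 → D.E} (hs : s ≠ 0) {γ : D.Γ} {ζ : D.E}
    (h : ((γ : GL (Fin 3) D.E) : Matrix (Fin 3) (Fin 3) D.E) *ᵥ s = ζ • s) : γ ∈ D.lineStab (D.E ∙ s) := by
  have hinj : Function.Injective ((γ : GL (Fin 3) D.E) : Matrix (Fin 3) (Fin 3) D.E).mulVec :=
    Matrix.mulVec_injective_iff_isUnit.2 (γ : GL (Fin 3) D.E).isUnit
  have hζ : ζ ≠ 0 := by
    rintro rfl
    rw [zero_smul] at h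
    exact hs (hinj (h.trans (Matrix.mulVec_zero _).symm))
  -- `γ⁻¹ s = ζ⁻¹ • s`
  have h' : (((γ⁻¹ : D.Γ) : GL (Fin 3) D.E) : Matrix (Fin 3) (Fin 3) D.E) *ᵥ s = ζ⁻¹ • s := by
    have h1 : (((γ⁻¹ : D.Γ) : GL (Fin 3) D.E) : Matrix (Fin 3) (Fin 3) D.E) *ᵥ
        (((γ : GL (Fin 3) D.E) : Matrix (Fin 3) (Fin 3) D.E) *ᵥ s) = s := by
      rw [Matrix.mulVec_mulVec, Subgroup.coe_inv, ← Units.val_mul, inv_mul_cancel, Units.val_one, Matrix.one_mulVec]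
    rw [h, Matrix.mulVec_smul] at h1
    have h2 := congrArg (fun v => ζ⁻¹ • v) h1
    simp only [smul_smul, inv_mul_cancel₀ hζ, one_smul] at h2
    exact h2
  refine D.mem_lineStab_of_forall_mem (fun w hw ↦ ?_) (fun w hw ↦ ?_)
  · obtain ⟨a, rfl⟩ := Submodule.mem_span_singleton.1 hw
    change ((γ : GL (Fin 3) D.E) : Matrix (Fin 3) (Fin 3) D.E) *ᵥ (a • s) ∈ D.E ∙ s
    rw [Matrix.mulVec_smul, h, smul_smul]
    exact Submodule.smul_mem _ _ (Submodule.mem_span_singleton_self s)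
  · obtain ⟨a, rfl⟩ := Submodule.mem_span_singleton.1 hw
    change (((γ⁻¹ : D.Γ) : GL (Fin 3) D.E) : Matrix (Fin 3) (Fin 3) D.E) *ᵥ (a • s) ∈ D.E ∙ s
    rw [Matrix.mulVec_smul, h', smul_smul]
    exact Submodule.smul_mem _ _ (Submodule.mem_span_singleton_self s)

/-! ### §3 Through the frame `ᵗσ(B)·H·B = J⋆ ⊕ᶠ J⊥` -/

/-- `J⊥` is non-degenerate: `det J⊥ = J⊥₀₀ = ⟨B e₃, B e₃⟩ ≠ 0` (anisotropy). [cite: Kudla1984, §1] -/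
theorem det_subformRight_ne_zero (hB : formCongr (conjRingHom D.E) B D.H = finSum 2 1 Jstar Jperp) : Jperp.det ≠ 0 := by
  rw [Matrix.det_fin_one, ← D.hermForm_lastCol_lastCol B Jstar Jperp hB]
  exact fun h ↦ D.lastCol_ne_zero B (D.anisotropic _ h)

/-- `J⋆` is non-degenerate (anisotropy). [cite: Kudla1984, §1] -/
theorem det_subformLeft_ne_zero (hB : formCongr (conjRingHom D.E) B D.H = finSum 2 1 Jstar Jperp) : Jstar.det ≠ 0 := by
  classical
  intro h
  obtain ⟨v, hv, hJv⟩ := Matrix.exists_mulVec_eq_zero_iff.2 h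
  refine hv (D.anisotropic_subform B Jstar Jperp hB v ?_)
  unfold hermForm
  rw [hJv, dotProduct_zero]

/-- An element of `Γ ≤ U(H)`, conjugated into the frame, is unitary for `J⋆ ⊕ᶠ J⊥`. [cite: Kudla1984, §1] -/
theorem conj_frame_mem_unitaryGroupOfForm (hB : formCongr (conjRingHom D.E) B D.H = finSum 2 1 Jstar Jperp) (γ : D.Γ) :
    B⁻¹ * (γ : GL (Fin 3) D.E) * B ∈ unitaryGroupOfForm (conjRingHom D.E) (finSum 2 1 Jstar Jperp) := by
  rw [← hB, ← conj_mem_unitaryGroupOfForm_iff]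
  have h : B * (B⁻¹ * (γ : GL (Fin 3) D.E) * B) * B⁻¹ = (γ : GL (Fin 3) D.E) := by group
  rw [h]
  exact mem_unitaryGroupOfForm_iff.2 (mem_unitaryGroup_iff.1 (D.isCongruenceSubgroup.1 γ.2))

/-- `B⁻¹ s = e₃ = 0 ⊕ 1` for `s = B e₃`. [cite: Kudla1984, §1] -/
theorem inv_mulVec_lastCol :
    ((B⁻¹ : GL (Fin 3) D.E) : Matrix (Fin 3) (Fin 3) D.E) *ᵥ (fun i => (B : Matrix (Fin 3) (Fin 3) D.E) i (Fin.last 2)) =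
      Fin.append (0 : Fin 2 → D.E) (fun _ : Fin 1 => 1) := by
  rw [D.lastCol_eq_mulVec_append B, Matrix.mulVec_mulVec, ← Units.val_mul, inv_mul_cancel, Units.val_one,
    Matrix.one_mulVec]

/-- `0 ⊕ (c·1) = c • (0 ⊕ 1)` (plumbing). [folklore] -/
private theorem append_zero_const_eq_smul (c : D.E) :
    Fin.append (0 : Fin 2 → D.E) (fun _ : Fin 1 => c) = c • Fin.append (0 : Fin 2 → D.E) (fun _ : Fin 1 => 1) := by
  funext k
  rw [Pi.smul_apply]
  induction k using Fin.addCases with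
  | left i => rw [Fin.append_left, Fin.append_left, Pi.zero_apply, smul_zero]
  | right j => rw [Fin.append_right, Fin.append_right, smul_eq_mul, mul_one]

/-- A `1 × 1` matrix acts on `S¹` by its entry (plumbing). [folklore] -/
private theorem fin_one_mulVec (ζ : Matrix (Fin 1) (Fin 1) D.E) (c : D.E) :
    ζ *ᵥ (fun _ : Fin 1 => c) = fun _ : Fin 1 => ζ 0 0 * c := by
  funext i
  rw [Subsingleton.elim i 0, Matrix.mulVec, dotProduct, Fin.sum_univ_one]

/-- **`B·(γ₁ ⊕ ζ)·B⁻¹` multiplies `s = B e₃` by `ζ₀₀`.** [cite: Kudla1984, §1] -/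
theorem conj_blockDiagGL_mulVec_lastCol (γ₁ : GL (Fin 2) D.E) (ζ : GL (Fin 1) D.E) :
    ((B * reindexGL finSumFinEquiv (blockDiagGL (γ₁, ζ)) * B⁻¹ : GL (Fin 3) D.E) : Matrix (Fin 3) (Fin 3) D.E) *ᵥ
        (fun i => (B : Matrix (Fin 3) (Fin 3) D.E) i (Fin.last 2)) =
      (ζ : Matrix (Fin 1) (Fin 1) D.E) 0 0 • fun i => (B : Matrix (Fin 3) (Fin 3) D.E) i (Fin.last 2) := by
  rw [Units.val_mul, Units.val_mul, ← Matrix.mulVec_mulVec, ← Matrix.mulVec_mulVec, D.inv_mulVec_lastCol B,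
    coe_reindexGL, coe_blockDiagGL]
  change (B : Matrix (Fin 3) (Fin 3) D.E) *ᵥ (finSum 2 1 (γ₁ : Matrix (Fin 2) (Fin 2) D.E) (ζ : Matrix (Fin 1) (Fin 1) D.E) *ᵥ
    Fin.append (0 : Fin 2 → D.E) (fun _ : Fin 1 => 1)) = _
  rw [finSum_mulVec_append, Matrix.mulVec_zero, fin_one_mulVec, mul_one, append_zero_const_eq_smul, Matrix.mulVec_smul,
    ← D.lastCol_eq_mulVec_append B]

/-- **`B·(γ₁ ⊕ ζ)·B⁻¹ ∈ Γ` lies in the stabiliser `Γ_W`, `W = E·(B e₃)`** (any `ζ`; the case `ζ = 1` is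
`conj_blockDiag_mem_lineStab`). [cite: KudlaMillson1990, Lemma 1.1, p. 128] -/
theorem conj_blockDiagGL_mem_lineStab {γ₁ : GL (Fin 2) D.E} {ζ : GL (Fin 1) D.E}
    (hγ : B * reindexGL finSumFinEquiv (blockDiagGL (γ₁, ζ)) * B⁻¹ ∈ D.Γ) :
    (⟨_, hγ⟩ : D.Γ) ∈ D.lineStab (D.E ∙ fun i => (B : Matrix (Fin 3) (Fin 3) D.E) i (Fin.last 2)) :=
  D.mem_lineStab_of_mulVec_eq_smul (D.lastCol_ne_zero B) (D.conj_blockDiagGL_mulVec_lastCol B γ₁ ζ)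

/-- `natAdd 2 k = last 2` in `Fin 3` (plumbing). [folklore] -/
private theorem natAdd_two_eq_last (k : Fin 1) : Fin.natAdd 2 k = Fin.last 2 := by
  ext; rw [Subsingleton.elim k 0]; rfl

/-- **An element of the stabiliser `Γ_W`, `W = E·(B e₃)`, is `B·(γ₁ ⊕ ζ)·B⁻¹` with `γ₁ ∈ U(J⋆)`, `ζ ∈ U(J⊥)`**: in the
frame, `γ` fixes the line `E·e₃`, so its upper-right block vanishes, and a unitary such matrix is block diagonal (§1).
[cite: Deligne1971TravauxShimura, Prop. 1.15 (proof, p. 132)] [cite: KudlaMillson1990, Lemma 1.1, p. 128] -/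
theorem exists_eq_conj_blockDiag_of_mem_lineStab (hB : formCongr (conjRingHom D.E) B D.H = finSum 2 1 Jstar Jperp)
    {γ : D.Γ} (hγ : γ ∈ D.lineStab (D.E ∙ fun i => (B : Matrix (Fin 3) (Fin 3) D.E) i (Fin.last 2))) :
    ∃ (γ₁ : GL (Fin 2) D.E) (ζ : GL (Fin 1) D.E), γ₁ ∈ unitaryGroupOfForm (conjRingHom D.E) Jstar ∧
      ζ ∈ unitaryGroupOfForm (conjRingHom D.E) Jperp ∧
      (γ : GL (Fin 3) D.E) = B * reindexGL finSumFinEquiv (blockDiagGL (γ₁, ζ)) * B⁻¹ := by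
  obtain ⟨c, hc⟩ := D.exists_mulVec_eq_smul_of_mem_lineStab hγ
  set g : GL (Fin 3) D.E := B⁻¹ * (γ : GL (Fin 3) D.E) * B with hgdef
  -- `g e₃ = c • e₃`
  have hge : (g : Matrix (Fin 3) (Fin 3) D.E) *ᵥ Fin.append (0 : Fin 2 → D.E) (fun _ : Fin 1 => 1) =
      c • Fin.append (0 : Fin 2 → D.E) (fun _ : Fin 1 => 1) := by
    rw [hgdef, Units.val_mul, Units.val_mul, ← Matrix.mulVec_mulVec, ← Matrix.mulVec_mulVec,
      ← D.lastCol_eq_mulVec_append B, hc, Matrix.mulVec_smul, D.inv_mulVec_lastCol B]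
  have hV : ∀ (i : Fin 2) (k : Fin 1), (g : Matrix (Fin 3) (Fin 3) D.E) (Fin.castAdd 1 i) (Fin.natAdd 2 k) = 0 := by
    intro i k
    have h1 := congrFun hge (Fin.castAdd 1 i)
    rw [Pi.smul_apply, Fin.append_left, Pi.zero_apply, smul_zero, append_zero_one_eq_single,
      Matrix.mulVec_single_one] at h1
    rw [natAdd_two_eq_last]
    exact h1
  obtain ⟨γ₁, ζ, hγ₁, hζ, hg⟩ := exists_eq_reindexGL_blockDiagGL_of_apply_castAdd_natAdd_eq_zero (conjRingHom D.E)
    (D.det_subformRight_ne_zero B Jstar Jperp hB) (D.conj_frame_mem_unitaryGroupOfForm B Jstar Jperp hB γ) hV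
  refine ⟨γ₁, ζ, hγ₁, hζ, ?_⟩
  rw [← hg]
  change (γ : GL (Fin 3) D.E) = B * (B⁻¹ * (γ : GL (Fin 3) D.E) * B) * B⁻¹
  group

/-- **Block form of the line stabiliser**: `γ ∈ Γ_W ↔ γ = B·(γ₁ ⊕ ζ)·B⁻¹` for some `γ₁ ∈ GL₂(E)`, `ζ ∈ GL₁(E)`
(`W = E·(B e₃)`; then automatically `γ₁ ∈ U(J⋆)`, `ζ ∈ U(J⊥)` by `exists_eq_conj_blockDiag_of_mem_lineStab`).
[cite: Deligne1971TravauxShimura, Prop. 1.15 (proof, p. 132)] [cite: KudlaMillson1990, Lemma 1.1, p. 128] -/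
theorem mem_lineStab_iff_exists_conj_blockDiag (hB : formCongr (conjRingHom D.E) B D.H = finSum 2 1 Jstar Jperp)
    (γ : D.Γ) :
    γ ∈ D.lineStab (D.E ∙ fun i => (B : Matrix (Fin 3) (Fin 3) D.E) i (Fin.last 2)) ↔
      ∃ (γ₁ : GL (Fin 2) D.E) (ζ : GL (Fin 1) D.E),
        (γ : GL (Fin 3) D.E) = B * reindexGL finSumFinEquiv (blockDiagGL (γ₁, ζ)) * B⁻¹ := by
  constructor
  · intro hγ
    obtain ⟨γ₁, ζ, -, -, h⟩ := D.exists_eq_conj_blockDiag_of_mem_lineStab B Jstar Jperp hB hγ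
    exact ⟨γ₁, ζ, h⟩
  · rintro ⟨γ₁, ζ, h⟩
    have hmem : B * reindexGL finSumFinEquiv (blockDiagGL (γ₁, ζ)) * B⁻¹ ∈ D.Γ := h ▸ γ.2
    have hγ' : γ = ⟨_, hmem⟩ := Subtype.ext h
    rw [hγ']
    exact D.conj_blockDiagGL_mem_lineStab B hmem

/-- `(Pi.single j 1) ⊕ 0 = Pi.single (castAdd j) 1` in the concatenated basis (plumbing). [folklore] -/
private theorem append_single_zero (j : Fin 2) :
    Fin.append (Pi.single j (1 : D.E)) (0 : Fin 1 → D.E) = Pi.single (Fin.castAdd 1 j) 1 := by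
  funext k
  induction k using Fin.addCases with
  | left j' =>
    rw [Fin.append_left]
    by_cases h : j' = j
    · subst h; rw [Pi.single_eq_same, Pi.single_eq_same]
    · rw [Pi.single_eq_of_ne h, Pi.single_eq_of_ne (fun h' => h ((Fin.castAdd_injective 2 1) h'))]
  | right i =>
    have hne : Fin.natAdd 2 i ≠ Fin.castAdd 1 j := by
      intro h
      have h' := congrArg Fin.val h
      simp only [Fin.val_castAdd, Fin.val_natAdd] at h'
      omega
    rw [Fin.append_right, Pi.zero_apply, Pi.single_eq_of_ne hne]

/-- **`Stab_Γ(W) = Stab_Γ(W^⊥)`**: `γ ∈ Γ` stabilises the line `W = E·(B e₃)` iff it maps `W^⊥ = B·(E² ⊕ 0)` into itself,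
`γ·B(x ⊕ 0) = B(y ⊕ 0)` — the frame-form hypothesis of `UnitaryGroupFrameStabiliser` /
`UnitaryShimuraCurveEmbeddingInjective` («`mapsTo_frame`»).  (`→`: block form; `←`: the `W^⊥`-stabiliser is block
diagonal by `UnitaryGroup.exists_eq_blockDiagFin_of_apply_natAdd_castAdd_eq_zero`, hence fixes the line `E·e₃`.)
[cite: Deligne1971TravauxShimura, Prop. 1.15 (proof, p. 132)] [cite: KudlaMillson1990, Lemma 1.1, p. 128] -/
theorem mem_lineStab_iff_mapsTo_frame (hB : formCongr (conjRingHom D.E) B D.H = finSum 2 1 Jstar Jperp) (γ : D.Γ) :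
    γ ∈ D.lineStab (D.E ∙ fun i => (B : Matrix (Fin 3) (Fin 3) D.E) i (Fin.last 2)) ↔
      ∀ x : Fin 2 → D.E, ∃ y : Fin 2 → D.E,
        ((γ : GL (Fin 3) D.E) : Matrix (Fin 3) (Fin 3) D.E) *ᵥ
            ((B : Matrix (Fin 3) (Fin 3) D.E) *ᵥ Fin.append x (0 : Fin 1 → D.E)) =
          (B : Matrix (Fin 3) (Fin 3) D.E) *ᵥ Fin.append y (0 : Fin 1 → D.E) := by
  constructor
  · intro hγ x
    obtain ⟨γ₁, ζ, -, -, h⟩ := D.exists_eq_conj_blockDiag_of_mem_lineStab B Jstar Jperp hB hγ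
    refine ⟨(γ₁ : Matrix (Fin 2) (Fin 2) D.E) *ᵥ x, ?_⟩
    rw [h, Units.val_mul, Units.val_mul, ← Matrix.mulVec_mulVec, ← Matrix.mulVec_mulVec, Matrix.mulVec_mulVec _
      ((B⁻¹ : GL (Fin 3) D.E) : Matrix (Fin 3) (Fin 3) D.E), ← Units.val_mul, inv_mul_cancel, Units.val_one,
      Matrix.one_mulVec, coe_reindexGL, coe_blockDiagGL]
    change (B : Matrix (Fin 3) (Fin 3) D.E) *ᵥ (finSum 2 1 (γ₁ : Matrix (Fin 2) (Fin 2) D.E)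
      (ζ : Matrix (Fin 1) (Fin 1) D.E) *ᵥ Fin.append x 0) = _
    rw [finSum_mulVec_append, Matrix.mulVec_zero]
  · intro hV
    -- `g := B⁻¹ γ B` maps `E² ⊕ 0` into itself
    set g : GL (Fin 3) D.E := B⁻¹ * (γ : GL (Fin 3) D.E) * B with hgdef
    have hV' : ∀ (i : Fin 1) (j : Fin 2), (g : Matrix (Fin 3) (Fin 3) D.E) (Fin.natAdd 2 i) (Fin.castAdd 1 j) = 0 := by
      intro i j
      obtain ⟨y, hy⟩ := hV (Pi.single j 1)
      have h1 : (g : Matrix (Fin 3) (Fin 3) D.E) *ᵥ Fin.append (Pi.single j (1 : D.E)) (0 : Fin 1 → D.E) =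
          Fin.append y (0 : Fin 1 → D.E) := by
        rw [hgdef, Units.val_mul, Units.val_mul, ← Matrix.mulVec_mulVec, ← Matrix.mulVec_mulVec, hy,
          Matrix.mulVec_mulVec, ← Units.val_mul, inv_mul_cancel, Units.val_one, Matrix.one_mulVec]
      have h2 := congrFun h1 (Fin.natAdd 2 i)
      rw [Fin.append_right, Pi.zero_apply, append_single_zero, Matrix.mulVec_single_one] at h2
      exact h2
    obtain ⟨γp, hγp⟩ := UnitaryGroup.exists_eq_blockDiagFin_of_apply_natAdd_castAdd_eq_zero (conjRingHom D.E)
      (D.det_subformLeft_ne_zero B Jstar Jperp hB) (D.conj_frame_mem_unitaryGroupOfForm B Jstar Jperp hB γ) hV'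
    rw [UnitaryGroup.coe_blockDiagFin_eq] at hγp
    have h : (γ : GL (Fin 3) D.E) =
        B * reindexGL finSumFinEquiv (blockDiagGL ((γp.1 : GL (Fin 2) D.E), (γp.2 : GL (Fin 1) D.E))) * B⁻¹ := by
      rw [← hγp]
      change (γ : GL (Fin 3) D.E) = B * (B⁻¹ * (γ : GL (Fin 3) D.E) * B) * B⁻¹
      group
    exact (D.mem_lineStab_iff_exists_conj_blockDiag B Jstar Jperp hB γ).2 ⟨_, _, h⟩

end UnitaryBallUniformisationDatum

end Literature.AlgebraicGeometry.ShimuraVarieties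

end
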